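import Literature.NumberTheory.Transcendental.HeightLocalGlobal
import HarnessLib

/-!
# Local estimates for the noncritical coordinate `t = 1/r + r^{m'}/s` on `r^e = x(1-x)`

[GenEll] = S. Mochizuki, *Arithmetic elliptic curves in general position*, Math. J. Okayama Univ. 52
(2010); abc-iut cell, route item `Summit.ABC.ABC.Theses.IUTThetaPilot.GenEllTwo`, S6's
number-field-only plan GENELLTWO-P1ROUTE §2(B)/§3(b), work package W4a. On the superelliptic curve
`D_e : r^e = x(1-x)` (`e` odd, `e + 1 = 2m'`, `s := 1 - 2x`) the function `t := 1/r + r^{m'}/s` has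
simple poles exactly over `x ∈ {0, 1, ∞}` and at the Weierstrass points `s = 0`, and
`e·(t)_∞ ∼ (e+3)·(x)_∞`; its Weil height therefore satisfies `e·h(t) = (e+3)·h(x) + O(1)` ([GenEll]
Prop. 1.4 (i), (iii)). Since `t` is not integral over `ℚ[x]` this is proved PLACE BY PLACE; this file
contains the local (single absolute value) estimates and the local-to-global bookkeeping, the global
statement is in `SuperellipticHeightsT.lean`. For an absolute value `v` on a field `K` with `2 ≠ 0`,
`X = v x`, `S = v s`, `T = v(r^{m'}/s)`, `D = max(v 2⁻¹, 1)`: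

* `mulHeight₁_prod_le_prod_of_forall_absValue` — local-to-global principle with products of
  `max(v ·, 1)`-factors on BOTH sides (extends the tree's
  `Transcendental.mulHeight₁_le_of_forall_absValue_le`); a factor `D` on the larger side is harmless
  globally (`H(2⁻¹) = H(2) ≤ 2^{[K:ℚ]}`).
* `tPart_upper(_of_isNonarchimedean)` — `max(T,1)^e ≤ C·D^e·max(X,1)·max(S⁻¹,1)^e` with `C = 4^e`
  (any `v`), `C = 1` (non-archimedean `v`);
* `tPart_lower(_of_isNonarchimedean)` — `max(X,1)·max(S⁻¹,1)^e ≤ C·max(T,1)^e` with `C = 24^e`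
  (any `v`), `C = 1` (non-archimedean); the identity `4x(1-x) = 1 - s²` (the Bezout relation
  `s² + 4r^e = 1`) controls the Weierstrass region;
* `tSum_lower(_of_isNonarchimedean)` — DISJOINT polar parts of `t₁ = 1/r` and `t₂ = r^{m'}/s`:
  `max(v t₁,1)·max(v t₂,1) ≤ 32·max(v(t₁+t₂),1)` (any `v`, `e ≥ 2`), `≤ max(v(t₁+t₂),1)`
  (non-archimedean).

Everything is proved; no definitions, no named facts; classical (local Weil functions, e.g.
Bombieri–Gubler §2.2–2.3) — nothing here refers to the disputed parts of the abc-iut corpus.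
-/

noncomputable section

open Height Height.AdmissibleAbsValues Finset Real
open Literature.NumberTheory.Transcendental

namespace Literature.NumberTheory.DiophantineGeometry

namespace Superelliptic

/-! ### Local-to-global with products on both sides -/

section LocalToGlobal

variable {K : Type*} [Field K] [AdmissibleAbsValues K]

/-- **Local-to-global principle, two-sided product form.** If
`Π_i max(v x_i, 1)^{e_i} ≤ C · Π_j max(v y_j, 1)^{a_j}` at every archimedean absolute value of the
admissible family and the same WITHOUT `C` at every non-archimedean one, then
`Π_i H(x_i)^{e_i} ≤ C^{totalWeight K} · Π_j H(y_j)^{a_j}` (the place-by-place bookkeeping behind the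
functoriality/additivity of Weil heights, [GenEll] Prop. 1.4 (i)).
[cite: MochizukiGenEll2010, Prop 1.4 (i) p.6] -/
theorem mulHeight₁_prod_le_prod_of_forall_absValue {ι κ : Type*} (s : Finset ι) (t : Finset κ)
    {x : ι → K} {e : ι → ℕ} {y : κ → K} {a : κ → ℕ} {C : ℝ}
    (harch : ∀ v ∈ archAbsVal,
      ∏ i ∈ s, max (v (x i)) 1 ^ e i ≤ C * ∏ j ∈ t, max (v (y j)) 1 ^ a j)
    (hna : ∀ v ∈ nonarchAbsVal,
      ∏ i ∈ s, max (v (x i)) 1 ^ e i ≤ ∏ j ∈ t, max (v (y j)) 1 ^ a j) :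
    ∏ i ∈ s, mulHeight₁ (x i) ^ e i ≤ C ^ totalWeight K * ∏ j ∈ t, mulHeight₁ (y j) ^ a j := by
  -- archimedean part
  have hA : (archAbsVal.map fun v => ∏ i ∈ s, max (v (x i)) 1 ^ e i).prod ≤
      (archAbsVal.map fun v => C * ∏ j ∈ t, max (v (y j)) 1 ^ a j).prod :=
    Multiset.prod_map_le_prod_map₀ _ _ (fun v _ => by positivity) fun v hv => harch v hv
  have hAx : (archAbsVal.map fun v => ∏ i ∈ s, max (v (x i)) 1 ^ e i).prod =
      ∏ i ∈ s, (archAbsVal.map fun v => max (v (x i)) 1).prod ^ e i := by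
    rw [Multiset.prod_map_prod]
    exact prod_congr rfl fun i _ => Multiset.prod_map_pow
  have hAy : (archAbsVal.map fun v => C * ∏ j ∈ t, max (v (y j)) 1 ^ a j).prod =
      C ^ totalWeight K * ∏ j ∈ t, (archAbsVal.map fun v => max (v (y j)) 1).prod ^ a j := by
    rw [Multiset.prod_map_mul, Multiset.map_const', Multiset.prod_replicate, Multiset.prod_map_prod,
      totalWeight]
    congr 1
    exact prod_congr rfl fun j _ => Multiset.prod_map_pow
  -- non-archimedean part
  have hN : ∏ᶠ v : nonarchAbsVal, ∏ i ∈ s, max (v.val (x i)) 1 ^ e i ≤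
      ∏ᶠ v : nonarchAbsVal, ∏ j ∈ t, max (v.val (y j)) 1 ^ a j :=
    finprod_le_finprod (hasFiniteMulSupport_prod_max_one_pow s x e) (fun v => by positivity)
      (hasFiniteMulSupport_prod_max_one_pow t y a) fun v => hna v.val v.prop
  have hNx : ∏ᶠ v : nonarchAbsVal, ∏ i ∈ s, max (v.val (x i)) 1 ^ e i =
      ∏ i ∈ s, (∏ᶠ v : nonarchAbsVal, max (v.val (x i)) 1) ^ e i := by
    rw [finprod_prod_comm s (fun (v : nonarchAbsVal) i => max (v.val (x i)) 1 ^ e i)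
      fun i _ => (hasFiniteMulSupport_max_one (x i)).pow (e i)]
    exact prod_congr rfl fun i _ => (finprod_pow (hasFiniteMulSupport_max_one (x i)) (e i)).symm
  have hNy : ∏ᶠ v : nonarchAbsVal, ∏ j ∈ t, max (v.val (y j)) 1 ^ a j =
      ∏ j ∈ t, (∏ᶠ v : nonarchAbsVal, max (v.val (y j)) 1) ^ a j := by
    rw [finprod_prod_comm t (fun (v : nonarchAbsVal) j => max (v.val (y j)) 1 ^ a j)
      fun j _ => (hasFiniteMulSupport_max_one (y j)).pow (a j)]
    exact prod_congr rfl fun j _ => (finprod_pow (hasFiniteMulSupport_max_one (y j)) (a j)).symm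
  have hApos : 0 ≤ (archAbsVal.map fun v => ∏ i ∈ s, max (v (x i)) 1 ^ e i).prod :=
    Multiset.prod_nonneg fun b hb => by
      obtain ⟨v, _, rfl⟩ := Multiset.mem_map.mp hb
      positivity
  have hNpos : 0 ≤ ∏ᶠ v : nonarchAbsVal, ∏ i ∈ s, max (v.val (x i)) 1 ^ e i :=
    finprod_nonneg fun v => by positivity
  calc ∏ i ∈ s, mulHeight₁ (x i) ^ e i
      = (archAbsVal.map fun v => ∏ i ∈ s, max (v (x i)) 1 ^ e i).prod *
          ∏ᶠ v : nonarchAbsVal, ∏ i ∈ s, max (v.val (x i)) 1 ^ e i := by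
        rw [hAx, hNx, ← prod_mul_distrib]
        exact prod_congr rfl fun i _ => by rw [← mul_pow, mulHeight₁_eq]
    _ ≤ (archAbsVal.map fun v => C * ∏ j ∈ t, max (v (y j)) 1 ^ a j).prod *
          ∏ᶠ v : nonarchAbsVal, ∏ j ∈ t, max (v.val (y j)) 1 ^ a j :=
        mul_le_mul hA hN hNpos (hApos.trans hA)
    _ = C ^ totalWeight K * ∏ j ∈ t, mulHeight₁ (y j) ^ a j := by
        rw [hAy, hNy, mul_assoc, ← prod_mul_distrib]
        congr 1
        exact prod_congr rfl fun j _ => by rw [← mul_pow, mulHeight₁_eq]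

end LocalToGlobal

/-! ### Elementary real-number helpers -/

/-- `max(T,1)^e ≤ R` from `T^e ≤ R` and `1 ≤ R`. [folklore] -/
private theorem max_one_pow_le {T R : ℝ} {e : ℕ} (h1 : T ^ e ≤ R) (h2 : 1 ≤ R) :
    max T 1 ^ e ≤ R := by
  rcases le_total T 1 with h | h
  · rw [max_eq_right h, one_pow]; exact h2
  · rw [max_eq_left h]; exact h1

/-- `A ≤ max(T,1)^e` from `A ≤ T^e`. [folklore] -/
private theorem le_max_one_pow {T A : ℝ} {e : ℕ} (hT : 0 ≤ T) (h : A ≤ T ^ e) :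
    A ≤ max T 1 ^ e :=
  h.trans (pow_le_pow_left₀ hT (le_max_left _ _) e)

/-! ### Local analysis -/

section Local

variable {K : Type*} [Field K] (v : AbsoluteValue K ℝ)

/-- `v(x(1-x)) ≥ (1 - v(1-2x)²)/4` for any absolute value: from `4·x(1-x) = 1 - (1-2x)²` (the
Bezout relation `s² + 4r^e = 1` between `s` and `r` on `D_e`) and `v(4) ≤ 4`.
[cite: MochizukiGenEll2010, Thm 2.1 proof p.11] -/
private theorem quarter_le (x : K) : (1 - v (1 - 2 * x) ^ 2) / 4 ≤ v (x * (1 - x)) := by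
  have h1 : v (4 * (x * (1 - x))) = v (1 - (1 - 2 * x) ^ 2) := by
    congr 1; ring
  rw [v.map_mul] at h1
  have h4 : v (4 : K) ≤ 4 := by exact_mod_cast v.apply_nat_le_self 4
  have h2 : 1 - v (1 - 2 * x) ^ 2 ≤ v (1 - (1 - 2 * x) ^ 2) := by
    have := v.le_sub 1 ((1 - 2 * x) ^ 2)
    rwa [v.map_one, v.map_pow] at this
  have h3 : v (4 : K) * v (x * (1 - x)) ≤ 4 * v (x * (1 - x)) :=
    mul_le_mul_of_nonneg_right h4 (v.nonneg _)
  linarith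

/-- `v(x(1-x)) ≥ 1` at a non-archimedean `v` when `v(1-2x) < 1` (and `2 ≠ 0`): from
`4·x(1-x) = 1 - (1-2x)²`. [cite: MochizukiGenEll2010, Thm 2.1 proof p.11] -/
private theorem one_le_of_isNonarchimedean (hv : IsNonarchimedean v) (h2 : (2 : K) ≠ 0) {x : K}
    (hS : v (1 - 2 * x) < 1) : 1 ≤ v (x * (1 - x)) := by
  have h1 : v (4 * (x * (1 - x))) = v (1 - (1 - 2 * x) ^ 2) := by
    congr 1; ring
  have hsq : v (-((1 - 2 * x) ^ 2)) < 1 := by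
    rw [v.map_neg, v.map_pow]; exact pow_lt_one₀ (v.nonneg _) hS two_ne_zero
  have h1ne : v (1 : K) ≠ v (-((1 - 2 * x) ^ 2)) := by rw [v.map_one]; exact hsq.ne'
  have h3 : v (1 - (1 - 2 * x) ^ 2) = 1 := by
    rw [sub_eq_add_neg, hv.add_eq_max_of_ne h1ne, v.map_one, max_eq_left hsq.le]
  rw [v.map_mul, h3] at h1
  have h4 : v (4 : K) ≤ 1 := by exact_mod_cast hv.apply_natCast_le_one (n := 4)
  have h40 : 0 < v (4 : K) := v.pos_iff.mpr (by
    have : (4 : K) = 2 * 2 := by norm_num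
    rw [this]; exact mul_ne_zero h2 h2)
  nlinarith [v.nonneg (x * (1 - x))]

variable {e m' : ℕ}

/-- `(v t₂)^e = (v x · v(1-x))^{m'} / (v s)^e` for `t₂ = r^{m'}/s`, `r^e = x(1-x)`, `e + 1 = 2m'`.
[cite: MochizukiGenEll2010, Thm 2.1 proof p.11] -/
private theorem tPart_pow {x r : K} (hr : r ^ e = x * (1 - x)) :
    v (r ^ m' / (1 - 2 * x)) ^ e = (v x * v (1 - x)) ^ m' / v (1 - 2 * x) ^ e := by
  rw [map_div₀, div_pow, v.map_pow, ← pow_mul, mul_comm m' e, pow_mul, ← v.map_pow, hr, v.map_mul]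

/-- `(Y·Y)^{m'} = Y^e·Y` when `e + 1 = 2m'`. [folklore] -/
private theorem mul_self_pow (hem : e + 1 = 2 * m') (Y : ℝ) : (Y * Y) ^ m' = Y ^ e * Y := by
  rw [mul_pow, ← pow_add, ← pow_succ, show m' + m' = e + 1 by omega]

/-- At a non-archimedean `v`: `v x > 1 ⟹ v(1 - x) = v x`. [folklore] -/
private theorem absValue_one_sub_of_one_lt (hv : IsNonarchimedean v) {x : K} (hX : 1 < v x) :
    v (1 - x) = v x := by
  have hne : v (1 : K) ≠ v (-x) := by rw [v.map_one, v.map_neg]; exact ne_of_lt hX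
  rw [sub_eq_add_neg, hv.add_eq_max_of_ne hne, v.map_one, v.map_neg, max_eq_right hX.le]

/-- At a non-archimedean `v`: `v(2x) < 1 ⟹ v(1 - 2x) = 1`. [folklore] -/
private theorem absValue_s_eq_one (hv : IsNonarchimedean v) {x : K} (h : v (2 * x) < 1) :
    v (1 - 2 * x) = 1 := by
  have hne : v (1 : K) ≠ v (-(2 * x)) := by rw [v.map_one, v.map_neg]; exact h.ne'
  rw [sub_eq_add_neg, hv.add_eq_max_of_ne hne, v.map_one, v.map_neg, max_eq_left h.le]

/-- At a non-archimedean `v`: `v(2x) > 1 ⟹ v(1 - 2x) = v(2x)`. [folklore] -/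
private theorem absValue_s_eq_of_one_lt (hv : IsNonarchimedean v) {x : K} (h : 1 < v (2 * x)) :
    v (1 - 2 * x) = v (2 * x) := by
  have hne : v (1 : K) ≠ v (-(2 * x)) := by rw [v.map_one, v.map_neg]; exact ne_of_lt h
  rw [sub_eq_add_neg, hv.add_eq_max_of_ne hne, v.map_one, v.map_neg, max_eq_right h.le]

/-- At a non-archimedean `v`: `v(1 - 2x) ≤ max(1, v 2 · v x)`. [folklore] -/
private theorem absValue_s_le (hv : IsNonarchimedean v) (x : K) :
    v (1 - 2 * x) ≤ max 1 (v 2 * v x) := by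
  rw [sub_eq_add_neg]
  refine (hv 1 (-(2 * x))).trans ?_
  rw [v.map_one, v.map_neg, v.map_mul]

/-- **Non-archimedean upper bound for `t₂ = r^{m'}/s`**:
`max(v t₂, 1)^e ≤ max(v 2⁻¹, 1)^e · max(v x, 1) · max(v s⁻¹, 1)^e`.
[cite: MochizukiGenEll2010, Prop 1.4 (i) p.6] -/
theorem tPart_upper_of_isNonarchimedean (hv : IsNonarchimedean v) (hem : e + 1 = 2 * m')
    (h2 : (2 : K) ≠ 0) {x r : K} (hr : r ^ e = x * (1 - x)) (hs : 1 - 2 * x ≠ 0) :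
    max (v (r ^ m' / (1 - 2 * x))) 1 ^ e ≤
      max (v (2 : K)⁻¹) 1 ^ e * max (v x) 1 * max (v (1 - 2 * x)⁻¹) 1 ^ e := by
  set X := v x with hX
  set S := v (1 - 2 * x) with hS
  set Dm := max (v (2 : K)⁻¹) 1 with hDm
  set Q := max (v (1 - 2 * x)⁻¹) 1 with hQ
  have hX0 : 0 ≤ X := v.nonneg _
  have hS0 : 0 < S := v.pos_iff.mpr hs
  have hv2 : 0 < v (2 : K) := v.pos_iff.mpr h2
  have hv2' : v (2 : K) ≤ 1 := by exact_mod_cast hv.apply_natCast_le_one (n := 2)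
  have hD : v (2 : K)⁻¹ = (v (2 : K))⁻¹ := map_inv₀ v 2
  have hSinv : v (1 - 2 * x)⁻¹ = S⁻¹ := map_inv₀ v _
  have hM1 : 1 ≤ max X 1 := le_max_right _ _
  have hD1 : 1 ≤ Dm := le_max_right _ _
  have hQ1 : 1 ≤ Q := le_max_right _ _
  have hinvD : (v (2 : K))⁻¹ ≤ Dm := by rw [hDm, hD]; exact le_max_left _ _
  have hDe1 : 1 ≤ Dm ^ e := one_le_pow₀ hD1
  have hQe1 : 1 ≤ Q ^ e := one_le_pow₀ hQ1
  have hRHS1 : 1 ≤ Dm ^ e * max X 1 * Q ^ e :=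
    one_le_mul_of_one_le_of_one_le (one_le_mul_of_one_le_of_one_le hDe1 hM1) hQe1
  have hTe : v (r ^ m' / (1 - 2 * x)) ^ e = (X * v (1 - x)) ^ m' / S ^ e := by
    rw [hX, hS]; exact tPart_pow v hr
  -- `1/S^e ≤ Q^e`
  have hSe : (S ^ e)⁻¹ ≤ Q ^ e := by
    rw [hQ, hSinv, ← inv_pow]; exact pow_le_pow_left₀ (by positivity) (le_max_left _ _) e
  refine max_one_pow_le ?_ hRHS1
  rw [hTe]
  rcases le_or_gt X 1 with hX1 | hX1
  · -- `X ≤ 1`: the numerator is `≤ 1`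
    have h1x : v (1 - x) ≤ 1 := by
      rw [sub_eq_add_neg]
      refine (hv 1 (-x)).trans ?_
      rw [v.map_one, v.map_neg]; exact max_le le_rfl hX1
    have hnum : (X * v (1 - x)) ^ m' ≤ 1 :=
      pow_le_one₀ (by positivity) (by nlinarith [v.nonneg (1 - x)])
    calc (X * v (1 - x)) ^ m' / S ^ e ≤ 1 / S ^ e := div_le_div_of_nonneg_right hnum (by positivity)
      _ = (S ^ e)⁻¹ := one_div _
      _ ≤ Q ^ e := hSe
      _ = 1 * 1 * Q ^ e := by ring
      _ ≤ Dm ^ e * max X 1 * Q ^ e :=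
          mul_le_mul_of_nonneg_right (mul_le_mul hDe1 hM1 zero_le_one (by positivity)) (by positivity)
  · -- `X > 1`: `v(1-x) = X`, numerator `= X^e·X`
    have h1x : v (1 - x) = X := absValue_one_sub_of_one_lt v hv hX1
    have hnum : (X * v (1 - x)) ^ m' = X ^ e * X := by rw [h1x]; exact mul_self_pow hem X
    rw [hnum]
    have hMX : max X 1 = X := max_eq_left hX1.le
    rcases le_or_gt (v 2 * X) 1 with h2X | h2X
    · -- `v(2x) ≤ 1`: `X ≤ 1/v2 ≤ Dm`, so `X^e ≤ Dm^e`, and `1/S^e ≤ Q^e`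
      have hXD : X ≤ Dm := by
        refine le_trans ?_ hinvD
        rw [inv_eq_one_div, le_div_iff₀ hv2, mul_comm]; exact h2X
      calc X ^ e * X / S ^ e = X ^ e * X * (S ^ e)⁻¹ := div_eq_mul_inv _ _
        _ ≤ Dm ^ e * max X 1 * Q ^ e := by
            rw [hMX]
            exact mul_le_mul (mul_le_mul_of_nonneg_right (pow_le_pow_left₀ hX0 hXD e) hX0) hSe
              (by positivity) (by positivity)
    · -- `v(2x) > 1`: `S = v2·X`
      have h2x : 1 < v (2 * x) := by rwa [v.map_mul]
      have hSeq : S = v 2 * X := by rw [hS, absValue_s_eq_of_one_lt v hv h2x, v.map_mul]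
      have hXne : X ≠ 0 := by positivity
      have hXe : X ^ e * X / S ^ e = (v (2 : K))⁻¹ ^ e * X := by
        rw [hSeq, mul_pow, mul_comm (v (2 : K) ^ e) (X ^ e), ← div_div,
          mul_div_cancel_left₀ X (pow_ne_zero e hXne), div_eq_mul_inv, inv_pow, mul_comm]
      rw [hXe, hMX]
      calc (v (2 : K))⁻¹ ^ e * X = (v (2 : K))⁻¹ ^ e * X * 1 := (mul_one _).symm
        _ ≤ Dm ^ e * X * Q ^ e :=
            mul_le_mul (mul_le_mul_of_nonneg_right (pow_le_pow_left₀ (by positivity) hinvD e) hX0)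
              hQe1 zero_le_one (by positivity)

/-- **Non-archimedean lower bound for `t₂ = r^{m'}/s`**:
`max(v x, 1) · max(v s⁻¹, 1)^e ≤ max(v t₂, 1)^e`. [cite: MochizukiGenEll2010, Prop 1.4 (i) p.6] -/
theorem tPart_lower_of_isNonarchimedean (hv : IsNonarchimedean v) (hem : e + 1 = 2 * m')
    (h2 : (2 : K) ≠ 0) {x r : K} (hr : r ^ e = x * (1 - x)) (hs : 1 - 2 * x ≠ 0) :
    max (v x) 1 * max (v (1 - 2 * x)⁻¹) 1 ^ e ≤ max (v (r ^ m' / (1 - 2 * x))) 1 ^ e := by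
  set X := v x with hX
  set S := v (1 - 2 * x) with hS
  set T := v (r ^ m' / (1 - 2 * x)) with hT
  have hX0 : 0 ≤ X := v.nonneg _
  have hS0 : 0 < S := v.pos_iff.mpr hs
  have hT0 : 0 ≤ T := v.nonneg _
  have hv2' : v (2 : K) ≤ 1 := by exact_mod_cast hv.apply_natCast_le_one (n := 2)
  have hSinv : v (1 - 2 * x)⁻¹ = S⁻¹ := map_inv₀ v _
  have hTe : T ^ e = (X * v (1 - x)) ^ m' / S ^ e := by rw [hT, hX, hS]; exact tPart_pow v hr
  have hSle : S ≤ max 1 (v 2 * X) := by rw [hS, hX]; exact absValue_s_le v hv x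
  have hmaxT1 : 1 ≤ max T 1 ^ e := one_le_pow₀ (le_max_right _ _)
  rw [hSinv]
  rcases lt_trichotomy X 1 with hX1 | hX1 | hX1
  · -- `X < 1`: `S = 1`, left side `= 1`
    have hS1 : S = 1 := by
      rw [hS]; exact absValue_s_eq_one v hv (by rw [v.map_mul]; nlinarith)
    rw [max_eq_right hX1.le, hS1, inv_one, max_self, one_pow, one_mul]
    exact hmaxT1
  · -- `X = 1`
    rw [hX1, max_self, one_mul]
    rcases lt_or_ge S 1 with hS1 | hS1
    · -- Weierstrass region: `v(x(1-x)) ≥ 1`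
      have hnum : 1 ≤ (X * v (1 - x)) ^ m' := by
        rw [hX, ← v.map_mul]; exact one_le_pow₀ (one_le_of_isNonarchimedean v hv h2 hS1)
      rw [max_eq_left (one_le_inv_iff₀.mpr ⟨hS0, hS1.le⟩)]
      refine le_max_one_pow hT0 ?_
      rw [hTe, inv_pow]
      calc (S ^ e)⁻¹ = 1 / S ^ e := (one_div _).symm
        _ ≤ (X * v (1 - x)) ^ m' / S ^ e := div_le_div_of_nonneg_right hnum (by positivity)
    · have hS1' : S = 1 :=
        le_antisymm (hSle.trans (max_le le_rfl (by rw [hX1, mul_one]; exact hv2'))) hS1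
      rw [hS1', inv_one, max_self, one_pow]
      exact hmaxT1
  · -- `X > 1`: `v(1-x) = X`
    have h1x : v (1 - x) = X := absValue_one_sub_of_one_lt v hv hX1
    have hnum : (X * v (1 - x)) ^ m' = X ^ e * X := by rw [h1x]; exact mul_self_pow hem X
    rw [max_eq_left hX1.le]
    refine le_max_one_pow hT0 ?_
    rw [hTe, hnum]
    have hXe1 : 1 ≤ X ^ e := one_le_pow₀ hX1.le
    rcases le_or_gt S 1 with hS1 | hS1
    · rw [max_eq_left (one_le_inv_iff₀.mpr ⟨hS0, hS1⟩), inv_pow, ← div_eq_mul_inv]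
      exact div_le_div_of_nonneg_right (le_mul_of_one_le_left hX0 hXe1) (by positivity)
    · rw [max_eq_right (inv_le_one_of_one_le₀ hS1.le), one_pow, mul_one]
      -- `S > 1` forces `S = v2·X ≤ X`
      have hSX : S ≤ X := by
        rcases le_or_gt (v 2 * X) 1 with h | h
        · exact absurd (hSle.trans (max_le le_rfl h)) (not_le.mpr hS1)
        · calc S ≤ max 1 (v 2 * X) := hSle
            _ = v 2 * X := max_eq_right h.le
            _ ≤ 1 * X := mul_le_mul_of_nonneg_right hv2' hX0
            _ = X := one_mul X
      have hXne : X ≠ 0 := by positivity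
      calc X = X ^ e * X / X ^ e := by field_simp
        _ ≤ X ^ e * X / S ^ e :=
            div_le_div_of_nonneg_left (by positivity) (by positivity) (pow_le_pow_left₀ hS0.le hSX e)

/-- **Disjoint polar parts of `t₁ = 1/r` and `t₂ = r^{m'}/s`, non-archimedean form**:
`max(v t₁, 1) · max(v t₂, 1) ≤ max(v(t₁ + t₂), 1)` — if `v t₁ > 1` then `v s = 1` and `v t₂ < 1`,
and ultrametrically the larger summand wins. [cite: MochizukiGenEll2010, Prop 1.4 (i) p.6] -/
theorem tSum_lower_of_isNonarchimedean (hv : IsNonarchimedean v) (hem : e + 1 = 2 * m')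
    (he : 0 < e) {x r : K} (hr : r ^ e = x * (1 - x)) (hr0 : r ≠ 0) (hs : 1 - 2 * x ≠ 0) :
    max (v r⁻¹) 1 * max (v (r ^ m' / (1 - 2 * x))) 1 ≤ max (v (r⁻¹ + r ^ m' / (1 - 2 * x))) 1 := by
  set X := v x with hX
  set S := v (1 - 2 * x) with hS
  set R := v r with hR
  set T := v (r ^ m' / (1 - 2 * x)) with hT
  have hR0 : 0 < R := v.pos_iff.mpr hr0
  have hS0 : 0 < S := v.pos_iff.mpr hs
  have hv2' : v (2 : K) ≤ 1 := by exact_mod_cast hv.apply_natCast_le_one (n := 2)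
  have hm'1 : 1 ≤ m' := by omega
  have ht1 : v r⁻¹ = R⁻¹ := map_inv₀ v r
  have hTdef : T = R ^ m' / S := by rw [hT, map_div₀, v.map_pow]
  have hRe : R ^ e = X * v (1 - x) := by rw [hR, ← v.map_pow, hr, v.map_mul]
  -- key: `R < 1 ⟹ S = 1`
  have hkey : R < 1 → S = 1 := by
    intro hR1
    have hRe1 : X * v (1 - x) < 1 := by rw [← hRe]; exact pow_lt_one₀ hR0.le hR1 he.ne'
    rcases lt_trichotomy X 1 with hX1 | hX1 | hX1
    · rw [hS]; exact absValue_s_eq_one v hv (by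
        rw [v.map_mul]; exact lt_of_le_of_lt (mul_le_of_le_one_left (v.nonneg _) hv2') hX1)
    · have h1x : v (1 - x) < 1 := by rwa [hX1, one_mul] at hRe1
      have hlt : v (2 * (1 - x)) < v (-1 : K) := by
        rw [v.map_neg, v.map_one, v.map_mul]
        exact lt_of_le_of_lt (mul_le_of_le_one_left (v.nonneg _) hv2') h1x
      have : (1 : K) - 2 * x = -1 + 2 * (1 - x) := by ring
      rw [hS, this, hv.add_eq_max_of_ne (ne_of_gt hlt), max_eq_left hlt.le, v.map_neg, v.map_one]
    · have h1x : v (1 - x) = X := absValue_one_sub_of_one_lt v hv hX1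
      rw [h1x] at hRe1; nlinarith
  rcases lt_or_ge R 1 with hR1 | hR1
  · -- `v t₁ > 1`, `v t₂ < 1`
    have hS1 : S = 1 := hkey hR1
    have hT1 : T < 1 := by rw [hTdef, hS1, div_one]; exact pow_lt_one₀ hR0.le hR1 (by omega)
    have ht1gt : 1 < v r⁻¹ := by rw [ht1]; exact one_lt_inv_iff₀.mpr ⟨hR0, hR1⟩
    have hne : v r⁻¹ ≠ v (r ^ m' / (1 - 2 * x)) := ne_of_gt (hT1.trans ht1gt)
    rw [max_eq_right hT1.le, mul_one, hv.add_eq_max_of_ne hne, max_eq_left (hT1.trans ht1gt).le]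
  · -- `v t₁ ≤ 1`
    have ht1le : v r⁻¹ ≤ 1 := by rw [ht1]; exact inv_le_one_of_one_le₀ hR1
    rw [max_eq_right ht1le, one_mul]
    rcases le_or_gt T 1 with hT1 | hT1
    · rw [max_eq_right hT1]; exact le_max_right _ _
    · have hne : v r⁻¹ ≠ v (r ^ m' / (1 - 2 * x)) := ne_of_lt (ht1le.trans_lt hT1)
      rw [hv.add_eq_max_of_ne hne, max_eq_right (ht1le.trans hT1.le)]

end Local

end Superelliptic

end Literature.NumberTheory.DiophantineGeometry

end
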